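import Literature.Geometry.Lorentzian.Stationary
import Literature.Geometry.Lorentzian.ModelDataProofs
import Literature.Geometry.Lorentzian.ModelDataNormalProofs
import Literature.Geometry.Lorentzian.TrivialDataAdmissible
import Literature.Geometry.Lorentzian.AsymptoticFlatnessProofs
import Literature.Geometry.Lorentzian.MinkowskiFlat
import Literature.Geometry.Lorentzian.NoncompactCauchyFutureSet
import HarnessLib

/-!
# Minkowski spacetime as a horizonless `StationaryAFBlackHole` (negative lane of crux
# `ZeroEnergyRigidity`, stmt-FinalStateConjecture-10690)

Support file of `MinkowskiNoHorizon.lean` (cdisprove seat, cycle 4): the presentation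
`minkowskiBH : StationaryAFBlackHole` of Minkowski spacetime `(ℝ⁴, η, ∂ₜ)` — slice `{t = 0}`,
trivial data `(δ, 0)`, end `{‖y‖ > 1}`, Killing field `∂ₜ`, every structure field a theorem of the
tree (`ModelData*`, `TrivialDataAdmissible`, `AsymptoticFlatnessProofs`, `MinkowskiFlat`) — and
its causal anatomy: `I^±(M_ext) = ℝ⁴` (straight timelike segments to/from the time translates of
the far region `{‖y‖ > 2}` of the end), hence `doc = ℝ⁴` (`doc_minkowskiBH`) and an EMPTY future
event horizon `𝓔⁺ = ∂I⁻(M_ext) ∩ I⁺(M_ext) = ∅` (`horizon_minkowskiBH`).  This is the junk model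
that hypothesis h2 (`IsConnected 𝓑.horizon`) of the crux — and only h2 — excludes; see
`MinkowskiNoHorizon.lean` for the refutation of the crux without h2.

References: B. O'Neill, *Semi-Riemannian geometry* (1983), Ch. 5 (causal cones of `ℝ⁴₁`) and
Ch. 14 (chronological futures); P. T. Chruściel, J. L. Costa, Astérisque 321 (2008), §2
(`M_ext = ⋃ₜ φₜ(Σ_ext)`, `⟨⟨M_ext⟩⟩`, `𝓔⁺`).
-/

noncomputable section

namespace Summit.FinalStateConjecture.FinalStateConjecture.Theorems.ZeroEnergyRigidity.Negative

open Set Function Literature.Geometry.Lorentzian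
open scoped Manifold ContDiff Topology

/-! ## Timelike segments of Minkowski spacetime -/

-- The metric and time orientation of `Minkowski.spacetime` (its fields, by `rfl`), written with
-- carrier syntactically `E4` so that the instances of `E4` apply (as in
-- `MinkowskiGlobalHyperbolicity.lean`).
local notation "η₄" => (LorentzianMetric.ofLE (n' := (∞ : ℕ∞ω)) Minkowski.metric le_top)
local notation "∂ₜ" => (TimeOrientation.ofLE (n' := (∞ : ℕ∞ω)) Minkowski.timeOrientation le_top)

section MinkowskiCausal

open Minkowski

/-- A straight segment `σ ↦ p + σ • (q − p)` of Minkowski spacetime whose increment is future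
timelike (`‖q̲ − p̲‖ < q⁰ − p⁰`) is a future-directed timelike curve. [folklore] -/
theorem isFutureTimelikeCurveOn_segment {p q : E4}
    (hq : ‖E4.spatial q - E4.spatial p‖ < q 0 - p 0) (s : Set ℝ) :
    LorentzianMetric.IsFutureTimelikeCurveOn η₄ ∂ₜ (fun σ : ℝ ↦ p + σ • (q - p)) s := by
  intro σ _
  set v : E4 := q - p with hv_def
  have hγ : HasDerivAt (fun σ : ℝ ↦ p + σ • v) v σ := by
    simpa using ((hasDerivAt_id σ).smul_const v).const_add p
  have hmd : MDifferentiableAt 𝓘(ℝ, ℝ) 𝓘(ℝ, E4) (fun σ : ℝ ↦ p + σ • v) σ :=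
    mdifferentiableAt_iff_differentiableAt.mpr hγ.differentiableAt
  have hvel : velocity 𝓘(ℝ, E4) (fun σ : ℝ ↦ p + σ • v) σ = v := by
    unfold velocity
    rw [mfderiv_eq_fderiv]
    change fderiv ℝ (fun σ : ℝ ↦ p + σ • v) σ 1 = v
    rw [hγ.hasFDerivAt.fderiv]
    simp
  have hv0 : v 0 = q 0 - p 0 := by simp [hv_def]
  have hsp : E4.spatial v = E4.spatial q - E4.spatial p := by simp [hv_def]
  have hlt : ‖E4.spatial v‖ < v 0 := by rw [hsp, hv0]; exact hq
  have hpos : 0 < v 0 := lt_of_le_of_lt (norm_nonneg _) hlt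
  have htl : bilin v v < 0 := by
    have h1 : bilin v v = -(v 0) ^ 2 + ‖E4.spatial v‖ ^ 2 := by
      rw [bilin_apply, EuclideanSpace.real_norm_sq_eq]
      simp [pow_two]
    have h2 : ‖E4.spatial v‖ ^ 2 < (v 0) ^ 2 := pow_lt_pow_left₀ hlt (norm_nonneg _) two_ne_zero
    rw [h1]; linarith
  have hvne : v ≠ 0 := by
    intro h
    rw [h] at hpos
    simp at hpos
  refine ⟨hmd, ?_, ⟨?_, ?_⟩, ?_⟩
  · change bilin (velocity 𝓘(ℝ, E4) (fun σ : ℝ ↦ p + σ • v) σ)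
      (velocity 𝓘(ℝ, E4) (fun σ : ℝ ↦ p + σ • v) σ) < 0
    rw [hvel]; exact htl
  · change bilin (velocity 𝓘(ℝ, E4) (fun σ : ℝ ↦ p + σ • v) σ)
      (velocity 𝓘(ℝ, E4) (fun σ : ℝ ↦ p + σ • v) σ) ≤ 0
    rw [hvel]; exact htl.le
  · change velocity 𝓘(ℝ, E4) (fun σ : ℝ ↦ p + σ • v) σ ≠ 0
    rw [hvel]; exact hvne
  · change bilin (E4.basisVector 0) (velocity 𝓘(ℝ, E4) (fun σ : ℝ ↦ p + σ • v) σ) < 0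
    rw [hvel, bilin_basisVector_zero_left]
    linarith

/-- `‖q̲ − p̲‖ < q⁰ − p⁰` puts `q` in the chronological future of `p` in Minkowski spacetime. [folklore] -/
theorem mem_chronologicalFuture_of_lt {p q : E4}
    (hq : ‖E4.spatial q - E4.spatial p‖ < q 0 - p 0) :
    q ∈ LorentzianMetric.chronologicalFuture η₄ ∂ₜ ({p} : Set E4) :=
  ⟨p, mem_singleton p, fun σ : ℝ ↦ p + σ • (q - p), 0, 1, zero_lt_one,
    isFutureTimelikeCurveOn_segment hq _, by simp, by simp⟩

/-- Every point of Minkowski spacetime has `(t, y)` in its chronological future once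
`t > p⁰ + ‖y − p̲‖`. [folklore] -/
theorem ofTimeSpace_mem_chronologicalFuture (p : E4) (y : E3) {t : ℝ}
    (ht : p 0 + ‖y - E4.spatial p‖ < t) :
    E4.ofTimeSpace t y ∈ LorentzianMetric.chronologicalFuture η₄ ∂ₜ ({p} : Set E4) := by
  apply mem_chronologicalFuture_of_lt
  rw [E4.spatial_ofTimeSpace, E4.ofTimeSpace_apply_zero]
  linarith

/-- Every point of Minkowski spacetime lies in the chronological future of `(t, y)` once
`t < p⁰ − ‖y − p̲‖`. [folklore] -/
theorem mem_chronologicalFuture_ofTimeSpace (p : E4) (y : E3) {t : ℝ}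
    (ht : t < p 0 - ‖y - E4.spatial p‖) :
    p ∈ LorentzianMetric.chronologicalFuture η₄ ∂ₜ ({E4.ofTimeSpace t y} : Set E4) := by
  apply mem_chronologicalFuture_of_lt
  rw [E4.spatial_ofTimeSpace, E4.ofTimeSpace_apply_zero, ← norm_neg, neg_sub]
  linarith

end MinkowskiCausal

/-! ## Minkowski spacetime as a `StationaryAFBlackHole` -/

section Presentation

open Minkowski

/-- The constant vector field `∂ₜ` on `E4`. [folklore] -/
def timeField : Π x : E4, TangentSpace 𝓘(ℝ, E4) x := fun _ ↦ E4.basisVector 0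

/-- `timeField x = ∂ₜ` (by `rfl`). [folklore] -/
@[simp] theorem timeField_apply (x : E4) : timeField x = E4.basisVector 0 := rfl

/-- `∂ₜ ≠ 0`. [folklore] -/
theorem basisVector_zero_ne_zero : (E4.basisVector 0 : E4) ≠ 0 := by
  intro h
  have h1 : (E4.basisVector 0 : E4) 0 = 1 := by simp [E4.basisVector]
  rw [h] at h1
  simp at h1

/-- `(0, y) + t ∂ₜ = (t, y)`. [folklore] -/
theorem ofTimeSpace_zero_add_smul (y : E3) (t : ℝ) :
    E4.ofTimeSpace 0 y + t • E4.basisVector 0 = E4.ofTimeSpace t y := by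
  ext i
  refine Fin.cases ?_ (fun j ↦ ?_) i
  · simp
  · simp [Fin.succ_ne_zero]

/-- The time translates `s ↦ x + s ∂ₜ` are integral curves of the constant field `∂ₜ`. [folklore] -/
theorem isMIntegralCurve_add_smul (x : E4) :
    IsMIntegralCurve (fun s : ℝ ↦ x + s • E4.basisVector 0) timeField := by
  intro t
  have h1 : HasDerivAt (fun s : ℝ ↦ x + s • E4.basisVector 0) (E4.basisVector 0) t := by
    simpa using ((hasDerivAt_id t).smul_const (E4.basisVector 0)).const_add x
  exact hasMFDerivAt_iff_hasFDerivAt.2 h1.hasFDerivAt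

/-- `∂ₜ` is a Killing field of the smooth Minkowski metric: its Levi-Civita connection is the
flat connection, which kills constant fields. [folklore] -/
theorem isKillingField_timeField [Minkowski.smoothMetric.toPseudoRiemannianMetric.HasLeviCivita] :
    Minkowski.smoothMetric.toPseudoRiemannianMetric.IsKillingField timeField := by
  refine ⟨(TimeOrientation.ofLE (n' := (∞ : ℕ∞ω)) Minkowski.timeOrientation le_top).contMDiff,
    fun x Y₀ Z₀ ↦ ?_⟩
  have h0 : Minkowski.smoothMetric.toPseudoRiemannianMetric.leviCivita timeField x = 0 := by
    rw [show timeField = fun _ : E4 ↦ (E4.basisVector 0 : E4) from rfl,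
      Minkowski.leviCivita_smoothMetric_eq_fderiv (differentiableAt_const _)]
    exact fderiv_const_apply _
  rw [h0]
  simp

/-- `∂ₜ` is complete on `E4`: its flow is the time translation. [folklore] -/
theorem isCompleteVectorField_timeField : IsCompleteVectorField timeField := fun x ↦
  ⟨fun s : ℝ ↦ x + s • E4.basisVector 0, isMIntegralCurve_add_smul x, by simp⟩

/-- `∂ₜ` is future-directed timelike everywhere in Minkowski spacetime. [folklore] -/
theorem isTimelike_timeField (x : E4) :
    LorentzianMetric.IsTimelike η₄ (timeField x) ∧
      TimeOrientation.IsFutureDirected ∂ₜ (timeField x) := by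
  have ht : Minkowski.bilin (E4.basisVector 0) (E4.basisVector 0) < 0 :=
    Minkowski.bilin_basisVector_zero.trans_lt neg_one_lt_zero
  exact ⟨ht, ⟨ht.le, basisVector_zero_ne_zero⟩, ht⟩

/-- **Minkowski spacetime `(ℝ⁴, η, ∂ₜ)` as a `StationaryAFBlackHole`**: slice `{t = 0} ≅ ℝ³`
with the trivial data `(δ, 0)` and its end `{‖y‖ > 1}`, Killing field `∂ₜ`.  Every field is a
theorem of the tree. [folklore] -/
def minkowskiBH : StationaryAFBlackHole.{0} where
  toSpacetime := Minkowski.spacetime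
  X := Minkowski.slice
  D := trivialData
  e := trivialAFEnd
  isAsymptoticallyFlat := ⟨1, one_pos,
    AFEnd.IsStronglyAsymptoticallyFlatDR.IsAsymptoticallyFlat_one_holds trivialAFEnd trivialData
      trivialAFEnd_isStronglyAsymptoticallyFlatCK_holds.isStronglyAsymptoticallyFlatDR⟩
  embed := Minkowski.sliceEmbed
  normal := Minkowski.sliceNormal
  isSmoothEmbedding := Minkowski.isSmoothEmbedding_sliceEmbed_holds
  isFutureUnitNormal := Minkowski.isFutureUnitNormal_sliceNormal_holds
  induced_h := Minkowski.pullbackBilin_sliceEmbed_holds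
  induced_k := by
    intro hLC y
    haveI : Minkowski.smoothMetric.toPseudoRiemannianMetric.HasLeviCivita := hLC
    exact Minkowski.secondFundamentalForm_sliceEmbed_holds y
  killing := timeField
  isStationary := by
    intro hLC
    haveI : Minkowski.smoothMetric.toPseudoRiemannianMetric.HasLeviCivita := hLC
    exact ⟨isKillingField_timeField, isCompleteVectorField_timeField,
      fun x _ ↦ isTimelike_timeField x⟩

/-- The spacetime of the Minkowski presentation is `Minkowski.spacetime` (by `rfl`). [folklore] -/
theorem minkowskiBH_toSpacetime : minkowskiBH.toSpacetime = Minkowski.spacetime := rfl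

/-- The stationary field of the Minkowski presentation is `∂ₜ` (by `rfl`). [folklore] -/
theorem minkowskiBH_killing : minkowskiBH.killing = timeField := rfl

/-- The points `(t, y)`, `‖y‖ > 2`, lie in `M_ext` of the Minkowski presentation (time
translates of the embedded far region `{‖y‖ > R + 1} = {‖y‖ > 2}` of the end). [folklore] -/
theorem ofTimeSpace_mem_Mext {y : E3} (hy : 2 < ‖y‖) (t : ℝ) :
    E4.ofTimeSpace t y ∈ minkowskiBH.Mext := by
  refine ⟨fun s : ℝ ↦ E4.ofTimeSpace 0 y + s • E4.basisVector 0, isMIntegralCurve_add_smul _,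
    ?_, t, ofTimeSpace_zero_add_smul y t⟩
  refine ⟨⟨y, Minkowski.mem_slice y⟩, ?_, ?_⟩
  · change (⟨y, Minkowski.mem_slice y⟩ : Minkowski.slice) ∈ trivialAFEnd.far (trivialAFEnd.R + 1)
    rw [trivialAFEnd_R, far_trivialAFEnd (by norm_num)]
    change (1 : ℝ) + 1 < ‖y‖
    linarith
  · change E4.ofTimeSpace 0 y = E4.ofTimeSpace 0 y + (0 : ℝ) • E4.basisVector 0
    simp

/-- **`I⁻(M_ext)` is everything** in the Minkowski presentation. [folklore] -/
theorem chronologicalPast_Mext_eq_univ :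
    LorentzianMetric.chronologicalPast η₄ ∂ₜ minkowskiBH.Mext = (univ : Set E4) := by
  refine eq_univ_of_forall fun p ↦ ?_
  rw [LorentzianMetric.mem_chronologicalPast_iff_exists]
  obtain ⟨y₀, hny⟩ := exists_norm_eq E3 (show (0 : ℝ) ≤ 3 by norm_num)
  refine ⟨E4.ofTimeSpace (p 0 + ‖y₀ - E4.spatial p‖ + 1) y₀,
    ofTimeSpace_mem_Mext (by rw [hny]; norm_num) _, ?_⟩
  exact ofTimeSpace_mem_chronologicalFuture p y₀ (by linarith)

/-- **`I⁺(M_ext)` is everything** in the Minkowski presentation. [folklore] -/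
theorem chronologicalFuture_Mext_eq_univ :
    LorentzianMetric.chronologicalFuture η₄ ∂ₜ minkowskiBH.Mext = (univ : Set E4) := by
  refine eq_univ_of_forall fun p ↦ ?_
  obtain ⟨y₀, hny⟩ := exists_norm_eq E3 (show (0 : ℝ) ≤ 3 by norm_num)
  have hq : E4.ofTimeSpace (p 0 - ‖y₀ - E4.spatial p‖ - 1) y₀ ∈ minkowskiBH.Mext :=
    ofTimeSpace_mem_Mext (by rw [hny]; norm_num) _
  have hp := mem_chronologicalFuture_ofTimeSpace p y₀
    (t := p 0 - ‖y₀ - E4.spatial p‖ - 1) (by linarith)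
  exact LorentzianMetric.chronologicalFuture_mono (singleton_subset_iff.mpr hq) hp

/-- The d.o.c. of the Minkowski presentation is the whole of `ℝ⁴`. [folklore] -/
theorem doc_minkowskiBH : minkowskiBH.doc = univ := by
  change LorentzianMetric.chronologicalFuture η₄ ∂ₜ minkowskiBH.Mext ∩
    LorentzianMetric.chronologicalPast η₄ ∂ₜ minkowskiBH.Mext = (univ : Set E4)
  rw [chronologicalFuture_Mext_eq_univ, chronologicalPast_Mext_eq_univ, univ_inter]

/-- **The Minkowski presentation has EMPTY future event horizon** `∂I⁻(M_ext) ∩ I⁺(M_ext)`. [folklore] -/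
theorem horizon_minkowskiBH : minkowskiBH.horizon = ∅ := by
  change frontier (LorentzianMetric.chronologicalPast η₄ ∂ₜ minkowskiBH.Mext) ∩
    LorentzianMetric.chronologicalFuture η₄ ∂ₜ minkowskiBH.Mext = (∅ : Set E4)
  rw [chronologicalPast_Mext_eq_univ, frontier_univ, empty_inter]

end Presentation


end Summit.FinalStateConjecture.FinalStateConjecture.Theorems.ZeroEnergyRigidity.Negative

end
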